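import Summits.AtomisticToContinuum.Crystallization.Theorems.CoarseGrains.Negative.PredicateAPI
import Summits.AtomisticToContinuum.Crystallization.Theorems.HcpLiouville.Negative.EquilLoadBearing

/-!
# `FineGrains` / Negative companion: the intended model — hcp pieces DO have fine balls (exactly)

Sanity / interface check for crux `stmt-AtomisticToContinuum-9330` (`ExcessDecayLiouville.FineGrains`),
standing crux-disprover seat `refuter-cdisprove-stmt-AtomisticToContinuum-9330-0` (2026-08-16): the
matrix of the crux has its INTENDED non-junk model.  For every isotropic admissible cell `a·id`,
`a ∈ [0.945, 0.995]` (`adm_smul_id_of_mem`), the ideal-ratio hcp crystal `hcpStacking a (a√(2/3))` is two-way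
matched at tolerance `0` on EVERY closed ball by the datum `t = (0, a(w + √(2/3)e₃))`, `A = a·id`
(`near_hcpStacking`; the site set IS the stacking, `hcpLiouvilleSites_eq_hcpStacking` of the sibling kit
`HcpLiouville/Negative/EquilLoadBearing`); more generally any `X` that agrees with the stacking on the
ball is matched there (`near_of_locally_hcp`).  Contrast `FccObstruction.not_near_of_locally_fcc`: the
matrix discriminates hcp from fcc, as the crux intends.  Nothing here closes an item; no theorem
concludes a Theses decl (these are statements about configurations, not about ground states).
-/

noncomputable section

open Literature.MathematicalPhysics.StatisticalMechanics

namespace Summit.AtomisticToContinuum.Crystallization.Theorems.FineGrains.Negative.HcpModel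

open Summit.AtomisticToContinuum.Crystallization.Theorems.CoarseGrains.Negative.PredicateAPI

/-- Isotropic cells `a·id` with `a ∈ [0.945, 0.995]` are admissible (`‖a·id − 0.97·id‖ = |a − 0.97|`).
[folklore] -/
theorem adm_smul_id_of_mem {a : ℝ} (ha : 189 / 200 ≤ a) (ha' : a ≤ 199 / 200) :
    Adm (a • ContinuousLinearMap.id ℝ E3) := by
  refine ⟨LinearIsometryEquiv.refl ℝ E3, ?_⟩
  have h0 : a • ContinuousLinearMap.id ℝ E3 - (97 / 100 : ℝ) •
      ((LinearIsometryEquiv.refl ℝ E3).toContinuousLinearEquiv : E3 →L[ℝ] E3) =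
      (a - 97 / 100) • ContinuousLinearMap.id ℝ E3 := by
    ext w
    simp [sub_smul]
  rw [h0, norm_smul, ContinuousLinearMap.norm_id, Real.norm_eq_abs, mul_one]
  rw [abs_le]; constructor <;> linarith

/-- The hcp datum: `t = (0, a(w + √(2/3)e₃))`. -/
def hcpDatum (a : ℝ) : Fin 2 → E3 := ![0, a • (barlowOffset 1 + layerNormal (Real.sqrt (2 / 3)))]

/-- The site set of the hcp datum with the isotropic cell `a·id` is `hcpStacking a (a√(2/3))`
(re-export of `hcpLiouvilleSites_eq_hcpStacking` over the named predicate `Lam`). [folklore] -/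
theorem sites_hcpDatum_eq (a : ℝ) :
    {p : E3 | ∃ m : Fin 2, ∃ z ∈ Lam, p = hcpDatum a m + (a • ContinuousLinearMap.id ℝ E3) z}
      = hcpStacking a (a * Real.sqrt (2 / 3)) :=
  hcpLiouvilleSites_eq_hcpStacking a

/-- **A set that agrees with `hcpStacking a (a√(2/3))` on the closed ball `B_ρ(c)` is two-way matched
there at tolerance `0`** by the hcp datum with cell `a·id`. [folklore] -/
theorem near_of_locally_hcp (a : ℝ) {X : Set E3} {c : E3} {ρ : ℝ}
    (h₁ : ∀ p ∈ X, dist p c ≤ ρ → p ∈ hcpStacking a (a * Real.sqrt (2 / 3)))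
    (h₂ : ∀ p ∈ hcpStacking a (a * Real.sqrt (2 / 3)), dist p c ≤ ρ → p ∈ X) :
    Near X c ρ (hcpDatum a) (a • ContinuousLinearMap.id ℝ E3) 0 := by
  have hS := sites_hcpDatum_eq a
  refine ⟨fun p hp hpc => ?_, fun m z hz hzc => ?_⟩
  · have hp' : p ∈ hcpStacking a (a * Real.sqrt (2 / 3)) := h₁ p hp hpc
    rw [← hS] at hp'
    obtain ⟨m, z, hz, rfl⟩ := hp'
    exact ⟨m, z, hz, by simp⟩
  · have hsite : hcpDatum a m + (a • ContinuousLinearMap.id ℝ E3) z ∈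
        hcpStacking a (a * Real.sqrt (2 / 3)) := by
      rw [← hS]; exact ⟨m, z, hz, rfl⟩
    exact ⟨_, h₂ _ hsite hzc, by simp⟩

/-- **The intended model:** the ideal-ratio hcp crystal `hcpStacking a (a√(2/3))` is two-way matched at
tolerance `0` on every closed ball by the admissible hcp datum (`a ∈ [0.945, 0.995]` for admissibility,
`adm_smul_id_of_mem`). [folklore] -/
theorem near_hcpStacking (a : ℝ) (c : E3) (ρ : ℝ) :
    Near (hcpStacking a (a * Real.sqrt (2 / 3))) c ρ (hcpDatum a) (a • ContinuousLinearMap.id ℝ E3) 0 :=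
  near_of_locally_hcp a (fun _ hp _ => hp) (fun _ hp _ => hp)

/-- Hence the matrix of `FineGrains` holds, at EVERY tolerance `ε ≥ 0` and every radius, for any
configuration that coincides with an ideal-ratio hcp crystal (`a ∈ [0.945, 0.995]`) on some closed
`ρ`-ball (the relaxed LJ hcp cell has `c/a` off ideal by `1.4·10⁻⁴`, absorbed by an anisotropic `A`,
not treated here) —
the crux's interface has its intended non-junk model (contrast `FccObstruction`). [folklore] -/
theorem fineGrains_matrix_of_locally_hcp {a : ℝ} (ha : 189 / 200 ≤ a) (ha' : a ≤ 199 / 200) {N : ℕ}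
    {x : Fin N → E3} {c : E3} {ρ ε : ℝ} (hε : 0 ≤ ε)
    (h₁ : ∀ p ∈ Set.range x, dist p c ≤ ρ → p ∈ hcpStacking a (a * Real.sqrt (2 / 3)))
    (h₂ : ∀ p ∈ hcpStacking a (a * Real.sqrt (2 / 3)), dist p c ≤ ρ → p ∈ Set.range x) :
    ∃ (c' : E3) (t : Fin 2 → E3) (A : E3 →L[ℝ] E3), Adm A ∧ Near (Set.range x) c' ρ t A ε := by
  refine ⟨c, hcpDatum a, a • ContinuousLinearMap.id ℝ E3, adm_smul_id_of_mem ha ha', ?_⟩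
  have h0 := near_of_locally_hcp a h₁ h₂
  exact ⟨fun p hp hpc => by
      obtain ⟨m, z, hz, hd⟩ := h0.1 p hp hpc
      exact ⟨m, z, hz, hd.trans hε⟩,
    fun m z hz hzc => by
      obtain ⟨p, hp, hd⟩ := h0.2 m z hz hzc
      exact ⟨p, hp, hd.trans hε⟩⟩

end Summit.AtomisticToContinuum.Crystallization.Theorems.FineGrains.Negative.HcpModel

end
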